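import Summits.Ventures.HSemireg.Pad4FirstOrderModel

/-!
# Venture HSemireg — PAD-4 on the paired-axes lattice (F1ℝ): RULE D, the static LEMMA-A∪2I′ kill predicates, and
# LEMMA T (the P-maximum of a slot kills) PROVED relative to the kill predicate

HONEST FRAMING. Lean index of the computation cell `pub-hsemireg` (S4-PUSH, H2 door PAD-4), typed by the Ventures-side
typer `hodge-lit-semireg-typer-2` on director-hodge g7's ROW SUPPLY order (ladder REQUESTS l.11011 (4), cell INBOX
l.30215): second of the `Pad4Tower*` files — **LEMMA A∪2I′** (PAD4-BALANCED-search-1.md v1.6 e2d93ac598b3704c §17,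
statement of record after s4-ref-2 g8's ×2, the CLEAN SUFFICIENT FORM and its own-ray instances = the static game of §18
(vii)∕(viii)) and **LEMMA T** (§18 (1)–(4), (v), (vi) P-MAX FORM; ×2 s4-ref g70 `VERDICT-LEMMA-T-…-S4-REF-G70-2026-08-27.md`
and s4-ref-2 g9 7a771f6b8d863ced: PASS with the proviso restated E-§18-1 ∕ O1 «no lifted class at ANY depth», precisions
P1 ((r2a) clause discharged) and P2 (M_P > 0) folded in, and E-§18-3 ∕ E1: `M_P` is the slot maximum over the `P`'s WITH A
ZERO COORDINATE ON `f″`, not over all `P`'s — the decoy-proof form; v2 of this file after s4-ref-2 g10's O1).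

THE SETTING (§1′ «(F1) IN LIGHT-CONE COORDINATES», §18 SETTING). Alphabet (F1ℝ) in the NON-NEGATIVE ORTHANT OF ONE APEX:
a constituent («cell») is an 8-tuple of light-cone coordinates `Z f s ∈ ℕ` (`f : Fin 4` the factor, `s : Fin 2` the side:
`0` = the `a`-coordinate ∕ null direction `+`, `1` = the `b`-coordinate ∕ direction `−`; `α_f = a_f + b_f`, `β_f = a_f − b_f`;
letters `O = (0,0)`, `ℓ_± = (1,0) ∕ (0,1)`, node `2I = (1,1)`, tower `2I+ℓ = (2,1)`, …). A CONFIGURATION is a pair of finite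
sets of cells (`lower` = the `N`'s = summands of `E₋`, `upper` = the `P`'s of `E₊`): MODE I, CLASSES ONLY (multiplicities,
sections and phases play no role in RULE D or in the static game). A LEG of an `N` along the coordinate `(f,s)` is a `P` that
agrees with it off `(f,s)` and is strictly smaller there (for a `P`: an `N` strictly larger there); `(f,s)` is then SERVED
(below ∕ above). An (r2a) partner moves exactly two coordinates on two different factors.

CONTENT.
* §1 vocabulary (all predicates are `abbrev`s over finite data — decidable by `decide` on concrete configurations; no
  `instance` is declared): `Agree1`, `Agree2`, `ServedBelow`, `ServedAbove`, `CoverBelow`, `CoverAbove`, `isO`, `pureRay`.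
* §2 **RULE D** (PAD4-BALANCED §1′, combinatorial form of the diagonal first-order criterion on (F1ℝ), WITH its (r2a) clause;
  = s4-search-1 `ruled_sat_q1.py`'s clause with `JOB_R2A=1`; the box runs of record used `R2A=0`, the strict sub-case — the
  (r2a) clause makes RULE D more permissive, so theorems assuming `RuleDClosed` here are the stronger ones): at an `N` (resp.
  `P`), any two coordinates on DIFFERENT factors with unequal values have one of them served below (resp. above) or are
  jointly (r2a)-covered; `RuleDClosed`.
* §3 **the static LEMMA-A∪2I′ kill predicates** (DEFINITIONS): `StaticDeadW0` — the `W = ∅` own-ray form (§18 (vii),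
  `JOB_LEMMAT=2`): an `N` with an O-factor `f″` and a pure ray on `(f′,s′)` all of whose PRESENT partners `Z − d·e_{(f′,s′)}`
  have the O-factor `f″` served above in BOTH directions, and such that NO lifted class `Z − d′·e_{(f′,s′)} + e‴·e_{(f″,v)}`
  (`1 ≤ d′ ≤ Z f′ s′`, `e‴ ≥ 1`, either `v`) is a `P` — the proviso in the ALL-DEPTH form demanded by s4-ref g70 E-§18-1 ∕
  s4-ref-2 g9 O1 (the machine's v5–v7 per-present-partner cousin escape was too narrow, s4-search-1 g21 l.30221; static8 v8
  has the complete census); `StaticDeadW1` — the `|W| = 1` own-ray form (v1.8 §18 (viii), `JOB_LEMMAT=3`; LEMMA A dualised; this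
  form is ×1 — no referee verdict on record for (viii)):
  `f″` a CHARGED pure ray of `Z` on side `v`, every present partner served above along `(f″,v)`, no lifted class along `v`.
  **WHAT THESE PREDICATES MEAN AND WHAT IS NOT IN LEAN.** LEMMA A∪2I′ (§17, pencil; census (3a)–(3d) + statement ×2
  s4-ref-2 g8) says: an `N` satisfying `StaticDeadW0` (resp. `StaticDeadW1`) VIOLATES (E1) — the full first-order
  obstruction system of its column is unsolvable for every choice of sections with non-zero leg entries (demanded plane
  `Ξ_{s′} ⊗ V_{f″}` resp. `Ξ_{s′} ⊗ V_{f″}∕Ξ_v` by PAIR-IMAGE with coefficient `Z f′ s′ ≠ 0`; fed only through the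
  `(f′,s′)`-partners; their `V_{f″}`-states confined to `Ξ₊ ∩ Ξ₋ = 0` resp. `Ξ_v` by the unpolluted `f″`-server rows; species
  (3c) empty ∕ in-pencil, (3d) empty in the non-negative orthant). THAT IMPLICATION IS NOT STATED IN LEAN: the first-order
  cohomology model of FILE A (`Pad4FirstOrderModel`, p505821) is the CLASS-y model — one apex per constituent, phase-pure
  same-layer pieces only — and has no (E1) for cells with nodes ∕ towers (it would need `H⁰` of timelike and `H¹` of
  spacelike classes on `E_i × E_i`); no 𝔅-model exists in the tree and none is axiomatised here. So in this file «dead»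
  means exactly «satisfies the static kill predicate»; its first-order meaning is the cell's pencil lemma, cited.
* §4 **LEMMA T, P-MAX FORM — PROVED relative to §3** (`lemmaT_server_confined`, `lemmaT_staticDead`,
  `lemmaT_staticDead_of_noLift`): in a RULE-D-closed configuration let `P₀ ∈ E₊` have an O-factor `f″ ≠ f` and let the slot
  `(f,s)` have its maximum `M > 0` over the `P`'s with a zero coordinate on `f″` attained at `P₀`; let `P₀` have a further
  factor `f′ ∉ {f,f″}` that is `O` or a pure ray on side `s′` of value `≠ M` (hypothesis (3)), and
  ((1′)) either both `f`-coordinates of `P₀` non-zero or a non-zero coordinate on the fourth factor. THEN `P₀` has a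
  server `Z = P₀ + e·e_{(f′,s′)} ∈ E₋` (`e ≥ 1`), `Z` has the O-factor `f″` and a pure ray on `(f′,s′)`, and EVERY present
  partner of `Z` along `(f′,s′)` has `f″` served above in both directions; with the lifted-class proviso, `StaticDeadW0`
  holds at `Z`. The proof is the referees' reading: ONE lemma `no_lower_above_slot` («no `N` with a zero coordinate on `f″`,
  a non-zero coordinate off the slot and off `f″`, and slot value `> M`» — by (α) = `servedBelow_of_zero` such an `N` has
  that coordinate served below by a `P` of slot value `> M`) discharges the CLAIM of (vi) AND every (r2a) alternative of
  RULE D (P1), and `M > 0` (P2) makes RULE D bite at the O-coordinates. Hypothesis (1′) is used only through «a non-zero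
  coordinate of `P₀` off the slot, off `f′` and off `f″`» (`¬ isO` on the fourth factor suffices; «charged» is not needed).
* §5 kernel probes (`decide`): the T376 top pattern of §18 REMARK (i) in isolation (`P(0⁶|1,3)`, a height-1 `(0,a)`-server
  and two height-1 O-factor servers — a PATTERN, not T376's actual servers), the j271928 top pattern of s4-ref g70's check (C)
  (`P₀ = (0,0|0,0|0,2|3,0)`, `Z = (0,0|1,0|0,2|3,0)`) with a negative probe, the DECOY probe (adding the isolated apex
  `P(4,4|4,4|4,4|4,4)` of witness-j271928: the unrestricted slot bound fails, the `f″`-restricted one holds), and the shape facts the director's squeeze ORDER l.30215 asks about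
  (o35∕o38∕o41 each have an O-factor and a pure-ray factor; the fully charged tower `[ℓ|ℓ|ℓ|2I+ℓ]` has neither an
  O-factor — so NEITHER static form has anything to bite, gs-eng-2 l.30224 ∕ director l.30226). These probes certify that
  the predicates compute; they are NOT certificates about T376 ∕ D_T1 as supports (not entered: 376 ∕ 14 416 cells).

WHAT IS NOT HERE. The (E1)-soundness of the kill predicates (LEMMA A∪2I′ itself — pencil ×2, above); the general §17
states `A_w(d)` with polluted servers, `|W| ≥ 2`, `Dir_σ` with several directions, μ₄ ∕ Pythagorean frames ((iii) is ×1);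
the W-game machines leak8∕leak9∕cegar; any UNSAT claim of the static games (kit results, s4-search-1); LEMMA T′ for
pure-tower columns (E-§18-2); THEOREM L^𝔅. Nothing is a statement about a variety, a sheaf, `σ`, a seed or an abelian
variety; NOTHING HERE SAYS THAT HC ∕ HC_CM ∕ HC_AV ∕ W₆ ∕ HC_Kum4Type HOLDS OR FAILS. No `instance`, no notation, no named
fact, 0 `sorry`; axioms standard. FILE A is imported for the cell's vocabulary lineage only (the class-y slice of this
alphabet at apex 0 = cells whose four factor points are `O` or pure rays; no seam lemma is claimed).

SOURCES (sha16): PAD4-BALANCED-search-1.md v1.6 e2d93ac598b3704c §1′ (PAIR-IMAGE, RULE D, (F1ℝ) light-cone form), §17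
(census, LEMMA A∪2I′ statement of record, CLEAN SUFFICIENT FORM, instances W = ∅ ∕ |W| = 1), §18 ((α)(β), (1)–(4), (v), (vi),
(vii)); v1.8 6ab75652c5d9909d §18 (viii)(ix) (|W| = 1 form, static results — not used); verdicts s4-ref g70 (§18 ×2, E-§18-1∕2∕3,
P1–P4), s4-ref-2 g9 7a771f6b8d863ced (§18 second ×2, O1 depth ≤ x+e), s4-ref-2 g8 743ff03f31655d32 ∕ e036450b1c974e99 (§17 ×2);
s4-search-1 g20 `code/g20/pad4/kitds/ruled_sat_q1.py` (RULE D clauses, LEMMAT=1∕2∕3), g21 l.30221 (static8 v8, complete census);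
gs-eng-2 g48 l.30224 + director-hodge g7 l.30226 (negative-Ψ carriers vs O-factor forms); FILE A b6b3015efa20709e (p505821).
-/

namespace Summit.Ventures.HSemireg.Pad4Tower

open Finset

/-! ## §1 Cells, configurations, legs -/

/-- a constituent of the (F1ℝ) alphabet in the non-negative orthant of one apex: light-cone coordinates `Z f s ∈ ℕ`
(`f` the factor; side `s = 0` the `a`∕`+` coordinate, `s = 1` the `b`∕`−` coordinate). [PAD4-BALANCED §1′, §18 SETTING] -/
abbrev Cell := Fin 4 → Fin 2 → ℕ

/-- a finite two-level configuration, classes only (mode I): `lower` = the `N`-cells (summands of `E₋`), `upper` = the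
`P`-cells (summands of `E₊`). -/
structure Config where
  /-- the `N`-cells (level `E₋`). -/
  lower : Finset Cell
  /-- the `P`-cells (level `E₊`). -/
  upper : Finset Cell

/-- `X` and `Y` agree off the coordinate `(f,s)`. -/
abbrev Agree1 (X Y : Cell) (f : Fin 4) (s : Fin 2) : Prop := ∀ g r, ¬ (g = f ∧ r = s) → X g r = Y g r

/-- `X` and `Y` agree off the two coordinates `(f,s)`, `(g,r)`. -/
abbrev Agree2 (X Y : Cell) (f : Fin 4) (s : Fin 2) (g : Fin 4) (r : Fin 2) : Prop :=
  ∀ h q, ¬ (h = f ∧ q = s) → ¬ (h = g ∧ q = r) → X h q = Y h q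

/-- the `N`-cell `Z` is SERVED BELOW along `(f,s)`: some `P` of the configuration is a leg `Z − d·e_{(f,s)}`, `d ≥ 1`. -/
abbrev ServedBelow (C : Config) (Z : Cell) (f : Fin 4) (s : Fin 2) : Prop :=
  ∃ P ∈ C.upper, Agree1 P Z f s ∧ P f s < Z f s

/-- the `P`-cell `P` is SERVED ABOVE along `(f,s)`: some `N` of the configuration is a server `P + e·e_{(f,s)}`, `e ≥ 1`. -/
abbrev ServedAbove (C : Config) (P : Cell) (f : Fin 4) (s : Fin 2) : Prop :=
  ∃ N ∈ C.lower, Agree1 N P f s ∧ P f s < N f s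

/-- (r2a) cover below: a `P` equal to `Z` except strictly smaller in exactly the two coordinates `(f,s)`, `(g,r)`. -/
abbrev CoverBelow (C : Config) (Z : Cell) (f : Fin 4) (s : Fin 2) (g : Fin 4) (r : Fin 2) : Prop :=
  ∃ P ∈ C.upper, Agree2 P Z f s g r ∧ P f s < Z f s ∧ P g r < Z g r

/-- (r2a) cover above: an `N` equal to `P` except strictly larger in exactly the two coordinates `(f,s)`, `(g,r)`. -/
abbrev CoverAbove (C : Config) (P : Cell) (f : Fin 4) (s : Fin 2) (g : Fin 4) (r : Fin 2) : Prop :=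
  ∃ N ∈ C.lower, Agree2 N P f s g r ∧ P f s < N f s ∧ P g r < N g r

/-- `f` is an O-FACTOR of `Z`: the factor point is the apex `O = (0,0)`. -/
abbrev isO (Z : Cell) (f : Fin 4) : Prop := Z f 0 = 0 ∧ Z f 1 = 0

/-- the factor point of `Z` on `f` is a PURE RAY on side `s`: non-zero there, zero on the other side. -/
abbrev pureRay (Z : Cell) (f : Fin 4) (s : Fin 2) : Prop := Z f s ≠ 0 ∧ Z f s.rev = 0

/-! ## §2 RULE D (the diagonal criterion on (F1ℝ), combinatorial form, with the (r2a) clause) -/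

/-- **RULE D at an `N`-cell** (PAD4-BALANCED §1′): for every two coordinates on DIFFERENT factors carrying unequal values, one
of them is served below or the pair is (r2a)-covered below (equivalently: any two UNSERVED coordinates on different factors are
equal unless (r2a)-covered). -/
abbrev RuleDN (C : Config) (Z : Cell) : Prop :=
  ∀ f g : Fin 4, f ≠ g → ∀ s r : Fin 2, Z f s ≠ Z g r → ServedBelow C Z f s ∨ ServedBelow C Z g r ∨ CoverBelow C Z f s g r

/-- **RULE D at a `P`-cell** (same, with service ∕ covers ABOVE). -/
abbrev RuleDP (C : Config) (P : Cell) : Prop :=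
  ∀ f g : Fin 4, f ≠ g → ∀ s r : Fin 2, P f s ≠ P g r → ServedAbove C P f s ∨ ServedAbove C P g r ∨ CoverAbove C P f s g r

/-- a RULE-D-CLOSED configuration: RULE D holds at every cell of both levels (= `ruled_sat_q1.py` models with `JOB_R2A=1`). -/
abbrev RuleDClosed (C : Config) : Prop := (∀ Z ∈ C.lower, RuleDN C Z) ∧ (∀ P ∈ C.upper, RuleDP C P)

/-! ## §3 The static LEMMA-A∪2I′ kill predicates (definitions; their (E1)-meaning is the cell's pencil lemma) -/

/-- a LIFTED CLASS on `Z`'s `(f′,s′)`-line over the O-factor `f″` (census species (3b) of §17, ALL depths — E-§18-1 ∕ O1): a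
cell that agrees with `Z` off `{(f′,s′)} ∪ f″`, lies strictly below `Z` on `(f′,s′)` (depth `d′ ≥ 1`), and whose `f″`-point
is a pure ray (`O + e‴·e_{(f″,v)}`, `e‴ ≥ 1`, either `v`). -/
abbrev LiftedClass (Z P : Cell) (f' : Fin 4) (s' : Fin 2) (f'' : Fin 4) : Prop :=
  (∀ g r, g ≠ f'' → ¬ (g = f' ∧ r = s') → P g r = Z g r) ∧ P f' s' < Z f' s' ∧ (pureRay P f'' 0 ∨ pureRay P f'' 1)

/-- **STATIC KILL, `W = ∅` OWN-RAY FORM** (LEMMA A∪2I′ with `Dir_{f′}(Z) = {s′}`, `W_{f″}(Z) = ∅`; §18 (vii) `JOB_LEMMAT=2` +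
the all-depth proviso): `Z` has the O-factor `f″` and a pure ray on `(f′,s′)` (`f′ ≠ f″`); EVERY partner `Z − d·e_{(f′,s′)}`
present in `E₊` has `f″` served above in BOTH directions (so its `V_{f″}`-state is confined to `Ξ₊ ∩ Ξ₋ = 0` by unpolluted
rows); and NO lifted class on the line is a `P`-cell. Pencil meaning (NOT in Lean): such a `Z` violates (E1). -/
abbrev StaticDeadW0 (C : Config) (Z : Cell) (f' : Fin 4) (s' : Fin 2) (f'' : Fin 4) : Prop :=
  f' ≠ f'' ∧ isO Z f'' ∧ pureRay Z f' s' ∧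
    (∀ P ∈ C.upper, Agree1 P Z f' s' → P f' s' < Z f' s' → ServedAbove C P f'' 0 ∧ ServedAbove C P f'' 1) ∧
    (∀ P ∈ C.upper, ¬ LiftedClass Z P f' s' f'')

/-- a lifted class along ONE direction `v` of a pure-ray factor `f″` (species (3b) for the `|W| = 1` form): agrees with `Z`
off `{(f′,s′), (f″,v)}`, strictly below on `(f′,s′)`, strictly above on `(f″,v)`. -/
abbrev LiftedClassDir (Z P : Cell) (f' : Fin 4) (s' : Fin 2) (f'' : Fin 4) (v : Fin 2) : Prop :=
  Agree2 P Z f' s' f'' v ∧ P f' s' < Z f' s' ∧ Z f'' v < P f'' v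

/-- **STATIC KILL, `|W| = 1` OWN-RAY FORM** (LEMMA A dualised to the `N`-side; §18 (viii) `JOB_LEMMAT=3` + all-depth proviso):
`Z` has pure rays on `(f′,s′)` and on `(f″,v)` (`f″` CHARGED, served below on `f″` at most along its own ray `v`); every
present partner `Z − d·e_{(f′,s′)}` has an `f″`-server ALONG `v` (confining its state into `Ξ_v`); no lifted class along `v`
is a `P`-cell (in-pencil (3c) members do not pollute; (3d) is empty in the orthant). Pencil meaning (NOT in Lean): such a
`Z` violates (E1) — the demanded quotient `Ξ_{s′} ⊗ V_{f″}∕Ξ_v` is not fed. -/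
abbrev StaticDeadW1 (C : Config) (Z : Cell) (f' : Fin 4) (s' : Fin 2) (f'' : Fin 4) (v : Fin 2) : Prop :=
  f' ≠ f'' ∧ pureRay Z f' s' ∧ pureRay Z f'' v ∧
    (∀ P ∈ C.upper, Agree1 P Z f' s' → P f' s' < Z f' s' → ServedAbove C P f'' v) ∧
    (∀ P ∈ C.upper, ¬ LiftedClassDir Z P f' s' f'' v)

/-! ## §4 LEMMA T, P-max form — proved relative to `StaticDeadW0` -/

section LemmaT

variable (C : Config)

/-- **(α) of §18**: at an `N`-cell satisfying RULE D, a zero coordinate on `f₀` forces every non-zero coordinate on every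
OTHER factor to be served below (the zero coordinate cannot be served or covered below — nothing is negative). -/
theorem servedBelow_of_zero {Z : Cell} (hZ : RuleDN C Z) {f₀ : Fin 4} {r₀ : Fin 2} (h0 : Z f₀ r₀ = 0)
    {g : Fin 4} {r : Fin 2} (hg : g ≠ f₀) (hne : Z g r ≠ 0) : ServedBelow C Z g r := by
  rcases hZ f₀ g hg.symm r₀ r (by omega) with h | h | h
  · obtain ⟨P, -, -, hlt⟩ := h
    omega
  · exact h
  · obtain ⟨P, -, -, hlt, -⟩ := h
    omega

variable {C}
/- The slot `(f,s)`, the factor `f″` (an O-factor of the top `P`), and `M` := the maximum of the slot over the `P`-cells WITH A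
ZERO COORDINATE ON `f″` — the decoy-proof form of `M_P` that both ×2 verdicts asked for (s4-ref g70 E-§18-3 «over P's with
at least one entry», s4-ref-2 g9 E1 «with an O-factor»; s4-ref-2 g10 O1 on v1 of this file: «zero on f″» is the form that
survives the (r2a) discharge): an isolated apex `P(c,c|c,c|c,c|c,c)` owning every unrestricted slot maximum (j271928's
witness) is outside the hypothesis. -/
variable (hC : RuleDClosed C) {f : Fin 4} {s : Fin 2} {M : ℕ} {f'' : Fin 4}
  (hmax : ∀ P ∈ C.upper, ∀ r₀ : Fin 2, P f'' r₀ = 0 → P f s ≤ M)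
include hC hmax

/-- **the engine of LEMMA T (vi)** (CLAIM + P1): no `N`-cell of a RULE-D-closed configuration has a zero coordinate on the
factor `f″`, a non-zero coordinate OFF the slot `(f,s)` on a factor other than `f″`, and slot value `> M` — by (α) that
non-zero coordinate is served below, by a `P` that inherits the zero on `f″` and whose slot value is still `> M`. -/
theorem no_lower_above_slot {N : Cell} (hN : N ∈ C.lower) {r₀ : Fin 2} (h0 : N f'' r₀ = 0)
    {g : Fin 4} {r : Fin 2} (hg : g ≠ f'') (hgs : ¬ (g = f ∧ r = s)) (hne : N g r ≠ 0) (hslot : M < N f s) : False := by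
  obtain ⟨P, hP, hagree, -⟩ := servedBelow_of_zero C (hC.1 N hN) h0 hg hne
  have h1 : P f s = N f s := hagree f s (by tauto)
  have h2 := hmax P hP r₀ (by rw [hagree f'' r₀ (by tauto)]; exact h0)
  omega

/-- no `P`-cell with O-factor `f″ ≠ f`, slot value `M`, and a non-zero coordinate off the slot and off `f″` is SERVED ABOVE in
the slot (the server would contradict `no_lower_above_slot`). This is the CLAIM of §18 (vi). -/
theorem not_servedAbove_slot {P : Cell} (hf'' : f'' ≠ f) (hO : isO P f'') (hPM : P f s = M)
    {g : Fin 4} {r : Fin 2} (hg : g ≠ f'') (hgs : ¬ (g = f ∧ r = s)) (hne : P g r ≠ 0) : ¬ ServedAbove C P f s := by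
  rintro ⟨N, hN, hagree, hlt⟩
  refine no_lower_above_slot hC hmax hN (f'' := f'') (r₀ := 0) ?_ hg hgs (r := r) ?_ ?_
  · rw [hagree f'' 0 (by tauto)]; exact hO.1
  · rwa [hagree g r hgs]
  · omega

/-- likewise no (r2a) COVER ABOVE of the slot together with a coordinate `(f₂, r₂)`, as long as the cover still has a zero
coordinate on `f″` and the witness non-zero coordinate is off both moved coordinates (P1, the (r2a) discharge). -/
theorem not_coverAbove_slot {P : Cell} {f₂ : Fin 4} {r₂ r₀ : Fin 2} (h0 : P f'' r₀ = 0)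
    (h0off : ¬ (f'' = f ∧ r₀ = s)) (h0off' : ¬ (f'' = f₂ ∧ r₀ = r₂)) (hPM : P f s = M)
    {g : Fin 4} {r : Fin 2} (hg : g ≠ f'') (hgs : ¬ (g = f ∧ r = s)) (hg2 : ¬ (g = f₂ ∧ r = r₂)) (hne : P g r ≠ 0) :
    ¬ CoverAbove C P f s f₂ r₂ := by
  rintro ⟨N, hN, hagree, hlt, -⟩
  refine no_lower_above_slot hC hmax hN (f'' := f'') (r₀ := r₀) ?_ hg hgs (r := r) ?_ ?_
  · rw [hagree f'' r₀ h0off h0off']; exact h0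
  · rwa [hagree g r hgs hg2]
  · omega

/-- **RULE D at a `P` sharing the pattern ⇒ its O-factor `f″` is served above in BOTH directions** (step (1)∕(4) of §18 with
P1∕P2): the slot `(f,s)` (value `M > 0`) is neither served nor coverable above, the O-coordinates are `0 ≠ M`. -/
theorem servedAbove_O_both {P : Cell} (hP : P ∈ C.upper) (hM : 0 < M) (hf'' : f'' ≠ f) (hO : isO P f'')
    (hPM : P f s = M) {g : Fin 4} {r : Fin 2} (hg : g ≠ f'') (hgs : ¬ (g = f ∧ r = s)) (hne : P g r ≠ 0) (v : Fin 2) :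
    ServedAbove C P f'' v := by
  have hv0 : P f'' v = 0 := by fin_cases v <;> simp [hO.1, hO.2]
  rcases hC.2 P hP f f'' (Ne.symm hf'') s v (by omega) with h | h | h
  · exact absurd h (not_servedAbove_slot hC hmax hf'' hO hPM hg hgs hne)
  · exact h
  · exfalso
    have hvr : P f'' v.rev = 0 := by fin_cases v <;> simp [hO.1, hO.2]
    refine not_coverAbove_slot hC hmax (f'' := f'') (r₀ := v.rev) hvr ?_ ?_ hPM hg hgs ?_ hne h
    · exact fun h' => hf'' h'.1
    · intro h'
      exact absurd h'.2 (by fin_cases v <;> decide)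
    · exact fun h' => hg h'.1

/-- **LEMMA T, P-MAX FORM (§18 (vi) with (v); ×2 g70 + 7a771f6b8d863ced) — the server exists and all its present partners
are confined.** Hypotheses: RULE-D-closed `C`; (2) an O-factor `f″ ≠ f` of `P₀ ∈ E₊`; slot `(f,s)` whose maximum `M > 0`
over the `P`-cells with a zero coordinate on `f″` is attained at `P₀` (E-§18-3 ∕ E1 form); (3) a factor `f′ ∉ {f, f″}` whose `s′.rev`-coordinate is `0` and whose `s′`-coordinate is `≠ M` (`f′` is `O`,
or a pure ray on side `s′` of value `≠ M`); (1′) a non-zero coordinate of `P₀` off the slot on a factor `∉ {f′, f″}` (both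
`f`-coordinates non-zero, or the fourth factor not `O`). Conclusion: some `Z ∈ E₋` is the server `P₀ + e·e_{(f′,s′)}`
(`e ≥ 1`), has the O-factor `f″` and a pure ray on `(f′,s′)`, and every `P ∈ E₊` that is a partner `Z − d·e_{(f′,s′)}` of it
has `f″` served above in both directions. -/
theorem lemmaT_server_confined {P₀ : Cell} (hP₀ : P₀ ∈ C.upper) (hM : 0 < M) (hP₀M : P₀ f s = M)
    (hf'' : f'' ≠ f) (hO : isO P₀ f'')
    {f' : Fin 4} (hf'f : f' ≠ f) (hf'f'' : f' ≠ f'') {s' : Fin 2} (h3 : P₀ f' s'.rev = 0 ∧ P₀ f' s' ≠ M)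
    {g : Fin 4} {r : Fin 2} (hgf' : g ≠ f') (hgf'' : g ≠ f'') (hgs : ¬ (g = f ∧ r = s)) (h1' : P₀ g r ≠ 0) :
    ∃ Z ∈ C.lower, Agree1 Z P₀ f' s' ∧ P₀ f' s' < Z f' s' ∧ isO Z f'' ∧ pureRay Z f' s' ∧
      ∀ P ∈ C.upper, Agree1 P Z f' s' → P f' s' < Z f' s' → ServedAbove C P f'' 0 ∧ ServedAbove C P f'' 1 := by
  -- RULE D at P₀ for the pair (f,s), (f′,s′): the slot is not served∕coverable above, so (f′,s′) is served above
  have hZ : ServedAbove C P₀ f' s' := by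
    rcases hC.2 P₀ hP₀ f f' (Ne.symm hf'f) s s' (by omega) with h | h | h
    · exact absurd h (not_servedAbove_slot hC hmax hf'' hO hP₀M hgf'' hgs h1')
    · exact h
    · exfalso
      refine not_coverAbove_slot hC hmax (f'' := f'') (r₀ := 0) hO.1 ?_ ?_ hP₀M hgf'' hgs ?_ h1' h
      · exact fun h' => hf'' h'.1
      · exact fun h' => hf'f'' h'.1.symm
      · exact fun h' => hgf' h'.1
  obtain ⟨Z, hZl, hZagree, hZlt⟩ := hZ
  refine ⟨Z, hZl, hZagree, hZlt, ?_, ?_, ?_⟩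
  · constructor
    · rw [hZagree f'' 0 (fun h' => hf'f'' h'.1.symm)]; exact hO.1
    · rw [hZagree f'' 1 (fun h' => hf'f'' h'.1.symm)]; exact hO.2
  · constructor
    · omega
    · rw [hZagree f' s'.rev (fun h' => absurd h'.2 (by fin_cases s' <;> decide))]; exact h3.1
  · intro P hP hPagree hPlt
    -- P agrees with P₀ off (f′,s′): it inherits the slot value, the O-factor and the witness coordinate
    have hPP₀ : ∀ h q, ¬ (h = f' ∧ q = s') → P h q = P₀ h q := fun h q hne => by
      rw [hPagree h q hne, hZagree h q hne]
    have hPM : P f s = M := by rw [hPP₀ f s (fun h' => hf'f h'.1.symm)]; exact hP₀M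
    have hPO : isO P f'' := by
      constructor
      · rw [hPP₀ f'' 0 (fun h' => hf'f'' h'.1.symm)]; exact hO.1
      · rw [hPP₀ f'' 1 (fun h' => hf'f'' h'.1.symm)]; exact hO.2
    have hPne : P g r ≠ 0 := by rw [hPP₀ g r (fun h' => hgf' h'.1)]; exact h1'
    exact ⟨servedAbove_O_both hC hmax hP hM hf'' hPO hPM hgf'' hgs hPne 0,
      servedAbove_O_both hC hmax hP hM hf'' hPO hPM hgf'' hgs hPne 1⟩

/-- **LEMMA T, P-MAX FORM ⇒ STATIC DEATH** (§18 (vi) HENCE-clause with the E-§18-1∕O1 proviso): the server `Z` of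
`lemmaT_server_confined` satisfies `StaticDeadW0` as soon as no `P`-cell is a lifted class on ITS line (depths `1 … Z f′ s′`,
the range of O1) — «the O-factor servers of the top `P` die unless cousin-protected». -/
theorem lemmaT_staticDead {P₀ : Cell} (hP₀ : P₀ ∈ C.upper) (hM : 0 < M) (hP₀M : P₀ f s = M)
    (hf'' : f'' ≠ f) (hO : isO P₀ f'')
    {f' : Fin 4} (hf'f : f' ≠ f) (hf'f'' : f' ≠ f'') {s' : Fin 2} (h3 : P₀ f' s'.rev = 0 ∧ P₀ f' s' ≠ M)
    {g : Fin 4} {r : Fin 2} (hgf' : g ≠ f') (hgf'' : g ≠ f'') (hgs : ¬ (g = f ∧ r = s)) (h1' : P₀ g r ≠ 0) :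
    ∃ Z ∈ C.lower, Agree1 Z P₀ f' s' ∧ P₀ f' s' < Z f' s' ∧ isO Z f'' ∧ pureRay Z f' s' ∧
      ((∀ P ∈ C.upper, ¬ LiftedClass Z P f' s' f'') → StaticDeadW0 C Z f' s' f'') := by
  obtain ⟨Z, hZl, hZagree, hZlt, hZO, hZray, hconf⟩ :=
    lemmaT_server_confined hC hmax hP₀ hM hP₀M hf'' hO hf'f hf'f'' h3 hgf' hgf'' hgs h1'
  exact ⟨Z, hZl, hZagree, hZlt, hZO, hZray, fun hprov => ⟨hf'f'', hZO, hZray, hconf, hprov⟩⟩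

/-- the same with a UNIFORM support-checkable proviso (no lifted class over `f″` at ANY point of the `(f′,s′)`-line through
`P₀` — stronger than needed, since the server's height is not known in advance). -/
theorem lemmaT_staticDead_of_noLift {P₀ : Cell} (hP₀ : P₀ ∈ C.upper) (hM : 0 < M) (hP₀M : P₀ f s = M)
    (hf'' : f'' ≠ f) (hO : isO P₀ f'')
    {f' : Fin 4} (hf'f : f' ≠ f) (hf'f'' : f' ≠ f'') {s' : Fin 2} (h3 : P₀ f' s'.rev = 0 ∧ P₀ f' s' ≠ M)
    {g : Fin 4} {r : Fin 2} (hgf' : g ≠ f') (hgf'' : g ≠ f'') (hgs : ¬ (g = f ∧ r = s)) (h1' : P₀ g r ≠ 0)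
    (hprov : ∀ P ∈ C.upper, (∀ h q, h ≠ f'' → ¬ (h = f' ∧ q = s') → P h q = P₀ h q) →
      ¬ (pureRay P f'' 0 ∨ pureRay P f'' 1)) :
    ∃ Z ∈ C.lower, Agree1 Z P₀ f' s' ∧ P₀ f' s' < Z f' s' ∧ StaticDeadW0 C Z f' s' f'' := by
  obtain ⟨Z, hZl, hZagree, hZlt, -, -, hdead⟩ :=
    lemmaT_staticDead hC hmax hP₀ hM hP₀M hf'' hO hf'f hf'f'' h3 hgf' hgf'' hgs h1'
  refine ⟨Z, hZl, hZagree, hZlt, hdead ?_⟩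
  rintro P hP ⟨hPagree, -, hPray⟩
  refine hprov P hP (fun h q hq hne => ?_) hPray
  rw [hPagree h q hq hne, hZagree h q hne]

end LemmaT

/-! ## §5 Kernel probes (the predicates compute; NOT certificates about the cell's supports) -/

/-- cell constructor from the eight light-cone coordinates `(a₀,b₀|a₁,b₁|a₂,b₂|a₃,b₃)`. -/
def cellOf (a₀ b₀ a₁ b₁ a₂ b₂ a₃ b₃ : ℕ) : Cell := fun f s => ![![a₀, b₀], ![a₁, b₁], ![a₂, b₂], ![a₃, b₃]] f s

/-- the T376 top pattern of §18 REMARK (i), in isolation: `P₀ = P(0⁶|1,3)` (slot `(3,b)`, `M = 3`), a height-1 `(0,a)`-server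
`Z = N(1,0|0⁴|1,3)`, and two height-1 servers of `P₀`'s O-factor `1` (a PATTERN — T376's own servers are other cells). -/
def t376Top : Config where
  lower := {cellOf 1 0 0 0 0 0 1 3, cellOf 0 0 1 0 0 0 1 3, cellOf 0 0 0 1 0 0 1 3}
  upper := {cellOf 0 0 0 0 0 0 1 3}

set_option synthInstance.maxSize 4096 in -- the unfolded predicate is one large decidable instance
/-- in the five-cell T376 top pattern the server `N(1,0|0⁴|1,3)` is static-dead (`f′ = 0`, side `a`, O-factor `f″ = 1`): its
only partner `P₀` has factor `1` served above in both directions, and no lifted class is present. [kernel, `decide`] -/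
theorem t376Top_staticDead : StaticDeadW0 t376Top (cellOf 1 0 0 0 0 0 1 3) 0 0 1 := by decide +kernel

/-- the j271928 top pattern (s4-ref g70 check (C), per-constituent reading): `P₀ = (0,0|0,0|0,2|3,0)`, `Z = P₀ + e_{(1,a)}`,
`f″ = 0` served both ways at `P₀`. -/
def j271928Top : Config where
  lower := {cellOf 0 0 1 0 0 2 3 0, cellOf 1 0 0 0 0 2 3 0, cellOf 0 1 0 0 0 2 3 0}
  upper := {cellOf 0 0 0 0 0 2 3 0}

set_option synthInstance.maxSize 4096 in -- as above
/-- `Z = (0,0|1,0|0,2|3,0)` is static-dead in the four-cell pattern (`f′ = 1`, side `a`, `f″ = 0`). [kernel, `decide`] -/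
theorem j271928Top_staticDead : StaticDeadW0 j271928Top (cellOf 0 0 1 0 0 2 3 0) 1 0 0 := by decide +kernel

set_option synthInstance.maxSize 4096 in -- as above
/-- the probe pattern is NOT vacuous the other way: with the server of `(0,b)` removed, `P₀`'s O-factor is served in one
direction only and the kill predicate FAILS (the partner is «unconfined-capable»). [kernel, `decide`] -/
theorem j271928Top_alive_if_unserved :
    ¬ StaticDeadW0 ⟨{cellOf 0 0 1 0 0 2 3 0, cellOf 1 0 0 0 0 2 3 0}, {cellOf 0 0 0 0 0 2 3 0}⟩ (cellOf 0 0 1 0 0 2 3 0) 1 0 0 := by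
  decide +kernel

/-- the DECOY of E-§18-3 ∕ E1: the j271928 pattern plus the isolated apex `P(4,4|4,4|4,4|4,4)` of witness-j271928 (no zero
coordinate). The UNRESTRICTED slot bound `∀ P ∈ E₊, P 3 a ≤ 3` FAILS (the decoy owns the maximum), the `f″ = 0`-RESTRICTED bound
of this file's `hmax` HOLDS with `M = 3` — so LEMMA T applies at `P₀` as the referees required. [kernel, `decide`] -/
theorem j271928Decoy_hmax :
    (¬ ∀ P ∈ ({cellOf 0 0 0 0 0 2 3 0, cellOf 4 4 4 4 4 4 4 4} : Finset Cell), P 3 0 ≤ 3) ∧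
    (∀ P ∈ ({cellOf 0 0 0 0 0 2 3 0, cellOf 4 4 4 4 4 4 4 4} : Finset Cell), ∀ r₀ : Fin 2, P 0 r₀ = 0 → P 3 0 ≤ 3) := by
  decide +kernel

/-- shape facts for the director's squeeze ORDER l.30215 and its correction l.30224∕l.30226: the three negative-Ψ orbits of
D_T1 — o35 `[O|ℓ|ℓ|2I+ℓ]`, o38 `[O|ℓ|2ℓ|2I+ℓ]`, o41 `[O|2ℓ|2ℓ|2I+ℓ]` — each HAVE an O-factor and a pure-ray factor (the
`W = ∅` form has a demand to test), whereas the fully charged tower `[ℓ|ℓ|ℓ|2I+ℓ]` (Ψ = −1) has NO O-factor and only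
pure-ray∕tower factors (neither static form applies: no O-factor for `W = ∅`; for `|W| = 1` it qualifies formally —
recorded, not adjudicated). [kernel, `decide`] -/
theorem squeeze_shapes :
    (isO (cellOf 0 0 1 0 1 0 2 1) 0 ∧ pureRay (cellOf 0 0 1 0 1 0 2 1) 1 0) ∧
    (isO (cellOf 0 0 1 0 2 0 2 1) 0 ∧ pureRay (cellOf 0 0 1 0 2 0 2 1) 1 0) ∧
    (isO (cellOf 0 0 2 0 2 0 2 1) 0 ∧ pureRay (cellOf 0 0 2 0 2 0 2 1) 1 0) ∧
    (∀ f : Fin 4, ¬ isO (cellOf 1 0 1 0 1 0 2 1) f) := by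
  decide +kernel

end Summit.Ventures.HSemireg.Pad4Tower
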